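import Literature.AlgebraicTopology.SingularHomology.LocalHomologyMayerVietoris
import Literature.AlgebraicTopology.SingularHomology.FundamentalClassExistence
import Literature.AlgebraicTopology.SingularHomology.UniverseTransportIso
import HarnessLib

/-!
# Two consequences of the relative Mayer–Vietoris sequence of local homology

A. Hatcher, *Algebraic Topology* (2002), §2.2 p. 152 / §3.3 Lemma 3.27: for closed `A, B ⊆ X` the
sequence `… → H_{i+1}(X | A) ⊕ H_{i+1}(X | B) → H_{i+1}(X | A ∩ B) →∂ H_i(X | A ∪ B)
→ H_i(X | A) ⊕ H_i(X | B) → …` is exact (proved in the tree in the concrete model,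
`clocalHomology.mv_exact₁₂₃`, `LocalHomologyMayerVietoris.lean`). This file records, in
Mathlib's model `localHomologyOfSet R M X K i = H_i(X, X ∖ K; M)` (through the comparison
`localHomologyOfSet.cmpIso`), the two consequences used to compute the local homology along a
union of two "cellular" pieces meeting in a circle-like set:

* `isZero_localHomologyOfSet_union` — if `H_i(X | A) = H_i(X | B) = 0` and the restriction
  `H_{i+1}(X | A) → H_{i+1}(X | A ∩ B)` is onto, then `H_i(X | A ∪ B) = 0`;
* `exists_linearEquiv_localHomologyOfSet_inter_union` — if `H_{i+1}` and `H_i` of `X | A` and of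
  `X | B` vanish, then `∂ : H_{i+1}(X | A ∩ B) ≃ H_i(X | A ∪ B)`.

Everything is proved; no named facts, no definitions.

## References

* A. Hatcher, *Algebraic Topology*, CUP 2002, §2.2 p. 152, §3.3 Lemma 3.27 [HatcherAT2002].
-/

noncomputable section

-- as in `LocalHomologyMayerVietoris`: chains of the concrete complex are `Finsupp`s up to unfolding
set_option backward.isDefEq.respectTransparency false

open CategoryTheory Limits Set Function

universe u v

namespace Literature.AlgebraicTopology.SingularHomology

variable (R : Type v) [CommRing R] (M : Type v) [AddCommGroup M] [Module R M]
variable {X : Type u} [TopologicalSpace X] {A B : Set X}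

namespace localHomologyOfSet

/-- Vanishing passes through the comparison with the concrete model. [folklore] -/
theorem isZero_clocalHomology_of_isZero {K : Set X} {i : ℕ} (h : IsZero (localHomologyOfSet R M X K i)) :
    IsZero (clocalHomology R M X K i) :=
  h.of_iso (localHomologyOfSet.cmpIso R M X K i).symm

/-- Restriction in the concrete model is conjugate to `restrictLocal` (elementwise form of
`cmpIso_hom_comp_res`). [folklore] -/
theorem res_cmpIso_hom_apply {K L : Set X} (h : L ⊆ K) (i : ℕ) (x : localHomologyOfSet R M X K i) :
    clocalHomology.res R M X h i ((localHomologyOfSet.cmpIso R M X K i).hom x) =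
      (localHomologyOfSet.cmpIso R M X L i).hom (restrictLocal R M h i x) := by
  rw [← ModuleCat.comp_apply, localHomologyOfSet.cmpIso_hom_comp_res, ModuleCat.comp_apply]

/-- **`H_i(X | A ∪ B) = 0` from the relative Mayer–Vietoris sequence** (Hatcher 2002, §2.2
p. 152): for closed `A`, `B` with `H_i(X | A) = H_i(X | B) = 0`, every class of `H_i(X | A ∪ B)`
is a boundary `∂β`, `β ∈ H_{i+1}(X | A ∩ B)` (exactness at `H_i(X | A ∪ B)`); if moreover the
restriction `H_{i+1}(X | A) → H_{i+1}(X | A ∩ B)` is onto then `β` is in the image of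
`H_{i+1}(X | A) ⊕ H_{i+1}(X | B)` and `∂β = 0` (exactness at `H_{i+1}(X | A ∩ B)`).
[cite: HatcherAT2002, §2.2 p. 152] -/
theorem isZero_localHomologyOfSet_union (hA : IsClosed A) (hB : IsClosed B) (i : ℕ)
    (hA₀ : IsZero (localHomologyOfSet R M X A i)) (hB₀ : IsZero (localHomologyOfSet R M X B i))
    (hsurj : Surjective (restrictLocal R M (Set.inter_subset_left : A ∩ B ⊆ A) (i + 1))) :
    IsZero (localHomologyOfSet R M X (A ∪ B) i) := by
  -- work in the concrete model
  suffices h : IsZero (clocalHomology R M X (A ∪ B) i) from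
    h.of_iso (localHomologyOfSet.cmpIso R M X (A ∪ B) i)
  have hA₀' := isZero_clocalHomology_of_isZero R M hA₀
  have hB₀' := isZero_clocalHomology_of_isZero R M hB₀
  haveI := ModuleCat.subsingleton_of_isZero hA₀'
  haveI := ModuleCat.subsingleton_of_isZero hB₀'
  have h₁ := clocalHomology.mv_exact₁ R M hA hB i
  have h₃ := clocalHomology.mv_exact₃ R M hA hB i
  rw [ModuleCat.isZero_iff_subsingleton]
  refine ⟨fun α α' => ?_⟩
  suffices hz : ∀ α : clocalHomology R M X (A ∪ B) i, α = 0 by rw [hz α, hz α']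
  intro α
  -- `α = ∂ β`
  have hres : clocalHomology.mvRes R M A B i α = 0 := Subsingleton.elim _ _
  obtain ⟨β, rfl⟩ := (h₁ α).1 hres
  -- `β` is restricted from `H_{i+1}(X | A)`
  obtain ⟨γ, hγ⟩ : ∃ γ : clocalHomology R M X A (i + 1),
      clocalHomology.res R M X (Set.inter_subset_left : A ∩ B ⊆ A) (i + 1) γ = β := by
    obtain ⟨β', hβ'⟩ := (localHomologyOfSet.cmpIso R M X (A ∩ B) (i + 1)).toLinearEquiv.surjective β
    obtain ⟨γ', rfl⟩ := hsurj β'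
    refine ⟨(localHomologyOfSet.cmpIso R M X A (i + 1)).hom γ', ?_⟩
    rw [res_cmpIso_hom_apply, ← hβ']
    rfl
  have hβ : β = clocalHomology.mvDiff R M A B (i + 1) (γ, 0) := by
    rw [clocalHomology.mvDiff_apply, map_zero, sub_zero, hγ]
  rw [hβ]
  exact h₃.apply_apply_eq_zero _

/-- **The Mayer–Vietoris connecting map `∂ : H_{i+1}(X | A ∩ B) ≃ H_i(X | A ∪ B)` is an
isomorphism when `H_{i+1}(X | A) = H_{i+1}(X | B) = H_i(X | A) = H_i(X | B) = 0`** (closed `A`,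
`B`; exactness at `H_{i+1}(X | A ∩ B)` gives injectivity, at `H_i(X | A ∪ B)` surjectivity;
Hatcher 2002, §2.2 p. 152), stated in Mathlib's model as a linear equivalence.
[cite: HatcherAT2002, §2.2 p. 152] -/
theorem exists_linearEquiv_localHomologyOfSet_inter_union (hA : IsClosed A) (hB : IsClosed B)
    (i : ℕ) (hA₁ : IsZero (localHomologyOfSet R M X A (i + 1)))
    (hB₁ : IsZero (localHomologyOfSet R M X B (i + 1)))
    (hA₀ : IsZero (localHomologyOfSet R M X A i)) (hB₀ : IsZero (localHomologyOfSet R M X B i)) :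
    Nonempty (localHomologyOfSet R M X (A ∩ B) (i + 1) ≃ₗ[R] localHomologyOfSet R M X (A ∪ B) i) := by
  haveI := ModuleCat.subsingleton_of_isZero (isZero_clocalHomology_of_isZero R M hA₀)
  haveI := ModuleCat.subsingleton_of_isZero (isZero_clocalHomology_of_isZero R M hB₀)
  haveI := ModuleCat.subsingleton_of_isZero (isZero_clocalHomology_of_isZero R M hA₁)
  haveI := ModuleCat.subsingleton_of_isZero (isZero_clocalHomology_of_isZero R M hB₁)
  have h₁ := clocalHomology.mv_exact₁ R M hA hB i
  have h₃ := clocalHomology.mv_exact₃ R M hA hB i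
  have hinj : Injective (clocalHomology.mvδ R M hA hB i) := by
    rw [injective_iff_map_eq_zero]
    intro β hβ
    obtain ⟨p, rfl⟩ := (h₃ β).1 hβ
    rw [Subsingleton.elim p 0, map_zero]
  have hsur : Surjective (clocalHomology.mvδ R M hA hB i) := by
    intro α
    exact (h₁ α).1 (Subsingleton.elim _ _)
  exact ⟨(localHomologyOfSet.cmpIso R M X (A ∩ B) (i + 1)).toLinearEquiv ≪≫ₗ
    (LinearEquiv.ofBijective _ ⟨hinj, hsur⟩ ≪≫ₗ
      (localHomologyOfSet.cmpIso R M X (A ∪ B) i).symm.toLinearEquiv)⟩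

end localHomologyOfSet

end Literature.AlgebraicTopology.SingularHomology
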